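import Literature.Analysis.FluidPDE.TaoCascadeEquationsOfMotion
import HarnessLib

/-!
# Tao's Lemma 4.1 (equations of motion) for a datum supported on one shell

T. Tao, *Finite time blowup for an averaged three-dimensional Navier–Stokes equation*, J. Amer.
Math. Soc. **29** (2016) 601–674 = arXiv:1402.0290v3, §4, Lemma 4.1 and its proof, pp. 21–23
[`Tao2016AveragedNS`]. The tree proves Lemma 4.1 for the printed datum (4.4) `u₀ = ψ_{i₀,n₀}`
(`TaoCascadeDuhamel.lean`, `TaoCascadeEquationsOfMotion.lean`: `equationsOfMotion_holds`). This
file runs the SAME proof for a datum supported on the shell `n₀` with arbitrary real mode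
amplitudes, `u₀ = ∑ᵢ X₀ᵢ ψ_{i,n₀}` (`shellDatum`): the datum enters the Duhamel representation of the
modes only through the real scalar `δ_{i,n} = X₀ᵢ·1_{n=n₀}` (`shellDelta`) multiplying the free wave
`e^{tΔ}ψ_{i,n}` — in the printed case `δ_{i,n} = 1_{(i,n)=(i₀,n₀)}` (`modeDelta`) — and every
estimate of the tree's proof is already stated for a general real `δ` (`duhamelScalar δ …`).

HONEST FRAMING (cell harvest/h2-tao-ladder, rung 1 of a ladder of MODEL equations): the cell's
split cascade operator is square-free, so its witness must load two wavelets at once,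
`u₀ = (ψ_{a′,n₀} + ψ_{a″,n₀})/√2` (`SplitCascadeReduction.lean`, `splitDatum`); this file supplies
the equations of motion for such data (`cascadeODESolutionFrom_of_mild`: a global mild solution of
`∂ₜu = Δu + C(u,u)`, `u(0) = ∑ᵢ X₀ᵢ ψ_{i,n₀}`, for ANY table `α` obeying (4.2)–(4.3) and any wavelet
data, has coefficients and local energies obeying `TaoCascade.CascadeODESolutionFrom … X₀`, with
the tree's implied constants `K₁ = 4√2π²(1+ε₀/2)²`, `K₂ = 8π²(1+ε₀/2)²`). It is a statement
about Tao's model class of local cascade equations; nothing here concerns Navier–Stokes.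

## Contents (sub-namespace `ShellDatum`; names parallel to the single-wavelet versions)

* `shellDelta`, `shellDatum`, `pairing_heat_shellDatum_modeProjection` (the free term seen by a
  mode), and then, verbatim with `modeDelta ↦ shellDelta`: the Duhamel identity and field
  (`pairing_modeProjection_eq_of_isMildSolutionFor`, `duhamelModeField`, …,
  `modeProjection_eq_duhamelModeField`), the frequency-integral formulas, the scalar functions
  `modeScalarX/E` and their derivatives and estimates, the `C¹` regularity, (4.10)–(4.12), the
  initial conditions `X_{i,n}(0) = X₀ᵢ1_{n=n₀}`, and the assembly `cascadeODESolutionFrom_of_mild`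
  ((4.13) from (4.3) by the tree's ODE-level Gronwall lemma `TaoCascade.eq_zero_of_lt_of_energy`).
-/

noncomputable section

open MeasureTheory Set Filter FourierTransform Metric
open scoped ENNReal NNReal SchwartzMap Topology RealInnerProductSpace Pointwise ComplexConjugate

namespace Literature.Analysis.FluidPDE.Tao2016

namespace ShellDatum

/-! ## The shell datum and the free term it contributes to each mode -/

section Datum

variable {ε₀ : ℝ} {m : ℕ}

/-- The amplitude `δ_{i,n} = X₀ᵢ · 1_{n = n₀}` with which the mode `(i,n)` sees the shell datum
`∑ⱼ X₀ⱼ ψ_{j,n₀}` (Tao's `1_{(i,n)=(i₀,n₀)}` for `X₀ = 1_{i₀}`). [cite: Tao2016AveragedNS, Lemma 4.1 (4.14)] -/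
def shellDelta (X₀ : Fin m → ℝ) (n₀ : ℤ) (i : Fin m) (n : ℤ) : ℝ := if n = n₀ then X₀ i else 0

/-- **The shell datum** `u₀ = ∑ᵢ X₀ᵢ ψ_{i,n₀} ∈ L²(ℝ³; ℂ³)`: a real combination of the wavelets of
one shell (Tao's (4.4) is `X₀ = 1_{i₀}`). [cite: Tao2016AveragedNS, §4 (4.4)] -/
def shellDatum (𝒟 : CascadeWaveletData ε₀ m) (X₀ : Fin m → ℝ) (n₀ : ℤ) : L2C :=
  ∑ j, ((X₀ j : ℝ) : ℂ) • cascadeWavelet ε₀ (𝒟.ψ j) n₀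

variable {𝒟 : CascadeWaveletData ε₀ m}

/-- The pairing is additive over finite sums in its first argument. [folklore] -/
private theorem pairing_sum_left {ι : Type*} (s : Finset ι) (v : ι → L2C) (w : L2C) :
    pairing (∑ j ∈ s, v j) w = ∑ j ∈ s, pairing (v j) w := by
  classical
  induction s using Finset.induction_on with
  | empty => simp [pairing_zero_left]
  | insert a s ha ih => rw [Finset.sum_insert ha, Finset.sum_insert ha, pairing_add_left, ih]

/-- The heat flow is additive over finite sums. [folklore] -/
private theorem heat_sum {ι : Type*} (s : Finset ι) (v : ι → L2C) (τ : ℝ) :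
    heat τ (∑ j ∈ s, v j) = ∑ j ∈ s, heat τ (v j) := by
  classical
  induction s using Finset.induction_on with
  | empty => simp [heat_apply_zero]
  | insert a s ha ih => rw [Finset.sum_insert ha, Finset.sum_insert ha, heat, fourierMultiplier_add, ← heat, ← heat, ih]

/-- The heat flow commutes with complex scalars. [folklore] -/
private theorem heat_smul (c : ℂ) (v : L2C) (τ : ℝ) : heat τ (c • v) = c • heat τ v := by
  rw [heat, fourierMultiplier_smul, ← heat]

/-- **The free evolution of the shell datum seen by the mode `(i,n)`**:
`⟨e^{tΔ} ∑ⱼ X₀ⱼψ_{j,n₀}, P_{i,n} w⟩ = X₀ᵢ1_{n=n₀} ⟨e^{tΔ} ψ_{i,n}, w⟩` (linearity and the tree's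
single-wavelet `pairing_heat_datum_modeProjection`). [cite: Tao2016AveragedNS, Lemma 4.1 (4.14)] -/
theorem pairing_heat_shellDatum_modeProjection (hε : 0 < ε₀) (t : ℝ) (w : L2C) (X₀ : Fin m → ℝ)
    (i : Fin m) (n₀ n : ℤ) :
    pairing (heat t (shellDatum 𝒟 X₀ n₀)) (modeProjection 𝒟 i n w) =
      ((shellDelta X₀ n₀ i n : ℝ) : ℂ) * pairing (heat t (cascadeWavelet ε₀ (𝒟.ψ i) n)) w := by
  rw [shellDatum, heat_sum, pairing_sum_left]
  simp_rw [heat_smul, pairing_smul_left, pairing_heat_datum_modeProjection hε]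
  rw [Finset.sum_eq_single i]
  · simp only [shellDelta, true_and]
    by_cases hn : n = n₀
    · subst hn; simp
    · simp [hn, Ne.symm hn]
  · intro j _ hji
    rw [if_neg (fun h => hji h.1), zero_mul, mul_zero]
  · intro hi; exact absurd (Finset.mem_univ i) hi

end Datum

/-! ## The Duhamel identity and the Duhamel field of a mode -/

section Support

variable {ε₀ : ℝ} {m : ℕ} {𝒟 : CascadeWaveletData ε₀ m}

/-- **The Duhamel identity for the projected solution** (Tao, p. 22, the display after (4.14):
`u_{i,n}(t) = e^{tΔ} X_{i,n}(0) ψ_{i,n} + ∑ α (1+ε₀)^{5(n-μ₃)/2} ∫₀ᵗ X X (t') e^{(t-t')Δ} ψ_{i,n} dt'`),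
in the weak form in which the mild formulation (3.3) is stated: for `t ≥ 0` and every test field
`w ∈ H¹⁰_df`,
`⟨P_{i,n} u(t), w⟩ = X₀ᵢ1_{n=n₀} ⟨e^{tΔ}ψ_{i,n}, w⟩ + ∫₀ᵗ quadTerm_{i,n}(u(s)) ⟨e^{(t-s)Δ}ψ_{i,n}, w⟩ ds`.
Proof: test (3.3) against `P_{i,n} w ∈ H¹⁰_df`; the free term is
`pairing_heat_shellDatum_modeProjection`; in the Duhamel term, `e^{(t-s)Δ} P_{i,n} w` is frequency
supported in `A_{i,n}`, so `⟨C(u,u), ·⟩` collapses (`cascadeOperatorForm_eq_quadTermC_mul`). [cite: Tao2016AveragedNS, Lemma 4.1 (4.14)] -/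
theorem pairing_modeProjection_eq_of_isMildSolutionFor (hε : 0 < ε₀)
    {α : Fin m → Fin m → Fin m → ℤ × ℤ × ℤ → ℝ} {X₀ : Fin m → ℝ} {n₀ : ℤ} {u : ℝ → L2C}
    (hu : IsMildSolutionFor (cascadeOperatorForm ε₀ 𝒟.ψ α) (shellDatum 𝒟 X₀ n₀) (Ici 0) u)
    (i : Fin m) (n : ℤ) {t : ℝ} (ht : 0 ≤ t) {w : L2C} (hw : MemH10df w) :
    pairing (modeProjection 𝒟 i n (u t)) w =
      ((shellDelta X₀ n₀ i n : ℝ) : ℂ) * pairing (heat t (cascadeWavelet ε₀ (𝒟.ψ i) n)) w +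
        ∫ s in (0 : ℝ)..t, quadTermC ε₀ 𝒟.ψ α (u s) i n *
          pairing (heat (t - s) (cascadeWavelet ε₀ (𝒟.ψ i) n)) w := by
  rw [pairing_modeProjection_left, hu.2.2 t ht _ (hw.modeProjection 𝒟 i n),
    pairing_heat_shellDatum_modeProjection hε]
  congr 1
  refine intervalIntegral.integral_congr fun s _ => ?_
  rw [cascadeOperatorForm_eq_quadTermC_mul (i := i) (n := n),
    pairing_heat_modeProjection_cascadeWavelet hε, pairing_swap w]
  intro j k hne
  exact ((isBandLimited_modeProjection i n w).heat (t - s)).pairing_cascadeWavelet_eq_zero hε hne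

end Support

section ModeField

variable {ε₀ : ℝ} {m : ℕ}

/-- **The Duhamel field of the mode `(i,n)`**:
`F_{i,n}(t) = X₀ᵢ1_{n=n₀} e^{tΔ} ψ_{i,n} + M_t(D) ψ_{i,n}`, `M_t(ξ) = ∫₀ᵗ Q_{i,n}(s) e^{-4π²(t-s)|ξ|²} ds`
— the right-hand side of the display after (4.14),
`u_{i,n}(t) = e^{tΔ} X_{i,n}(0) ψ_{i,n} + ∫₀ᵗ [quadTerm](t') e^{(t-t')Δ} ψ_{i,n} dt'`, as an honest
element of `L²` (a Fourier multiplier applied to `ψ_{i,n}`). [cite: Tao2016AveragedNS, Lemma 4.1 (4.14)] -/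
def duhamelModeField (𝒟 : CascadeWaveletData ε₀ m) (α : Fin m → Fin m → Fin m → ℤ × ℤ × ℤ → ℝ)
    (u : ℝ → L2C) (i : Fin m) (n : ℤ) (X₀ : Fin m → ℝ) (n₀ : ℤ) (t : ℝ) : L2C :=
  ((shellDelta X₀ n₀ i n : ℝ) : ℂ) • heat t (cascadeWavelet ε₀ (𝒟.ψ i) n) +
    fourierMultiplier (duhamelSymbol (modeForcing 𝒟 α u i n) t) (cascadeWavelet ε₀ (𝒟.ψ i) n)

end ModeField

section ModeFieldProps

variable {ε₀ : ℝ} {m : ℕ} {𝒟 : CascadeWaveletData ε₀ m}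
  {α : Fin m → Fin m → Fin m → ℤ × ℤ × ℤ → ℝ} {u : ℝ → L2C} {X₀ : Fin m → ℝ} {i : Fin m} {n₀ n : ℤ}

/-- **The pairings of the Duhamel field**:
`⟨F_{i,n}(t), w⟩ = X₀ᵢ1_{n=n₀} ⟨e^{tΔ}ψ_{i,n}, w⟩ + ∫₀ᵗ Q_{i,n}(s) ⟨e^{(t-s)Δ}ψ_{i,n}, w⟩ ds`
(linearity and the Fubini lemma `pairing_fourierMultiplier_duhamelSymbol`). [cite: Tao2016AveragedNS, Lemma 4.1 (4.14)] -/
theorem pairing_duhamelModeField (hu : ContinuousInH10On (Ici 0) u) {t : ℝ} (ht : 0 ≤ t) (w : L2C) :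
    pairing (duhamelModeField 𝒟 α u i n X₀ n₀ t) w =
      ((shellDelta X₀ n₀ i n : ℝ) : ℂ) * pairing (heat t (cascadeWavelet ε₀ (𝒟.ψ i) n)) w +
        ∫ s in (0 : ℝ)..t, modeForcing 𝒟 α u i n s *
          pairing (heat (t - s) (cascadeWavelet ε₀ (𝒟.ψ i) n)) w := by
  rw [duhamelModeField, pairing_add_left, pairing_smul_left,
    pairing_fourierMultiplier_duhamelSymbol (continuous_modeForcing hu) ht]

/-- **The projected mild solution and the Duhamel field have the same pairings against
`H¹⁰_df`**: for `t ≥ 0` and `w ∈ H¹⁰_df`, `⟨P_{i,n} u(t), w⟩ = ⟨F_{i,n}(t), w⟩`. [cite: Tao2016AveragedNS, Lemma 4.1 (4.14)] -/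
theorem pairing_modeProjection_eq_pairing_duhamelModeField (hε : 0 < ε₀)
    (hu : IsMildSolutionFor (cascadeOperatorForm ε₀ 𝒟.ψ α) (shellDatum 𝒟 X₀ n₀) (Ici 0) u)
    {t : ℝ} (ht : 0 ≤ t) {w : L2C} (hw : MemH10df w) :
    pairing (modeProjection 𝒟 i n (u t)) w = pairing (duhamelModeField 𝒟 α u i n X₀ n₀ t) w := by
  rw [pairing_modeProjection_eq_of_isMildSolutionFor hε hu i n ht hw, pairing_duhamelModeField hu.2.1 ht]
  congr 1
  · refine intervalIntegral.integral_congr fun s hs => ?_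
    rw [uIcc_of_le ht] at hs
    show _ = modeForcing 𝒟 α u i n s * _
    rw [modeForcing_of_nonneg hs.1]

/-- The Duhamel field is band-limited to the region of its mode. [cite: Tao2016AveragedNS, Lemma 4.1] -/
theorem isBandLimited_duhamelModeField (hε : 0 < 1 + ε₀) (t : ℝ) :
    IsBandLimited (freqRegion 𝒟 i n) (duhamelModeField 𝒟 α u i n X₀ n₀ t) :=
  (((isBandLimited_cascadeWavelet hε i n).heat t).smul _).add
    ((isBandLimited_cascadeWavelet hε i n).fourierMultiplier _)

/-- **The Duhamel field lies in `H¹⁰_df`** (finite `H¹⁰` norm: bounded multipliers of the `H¹⁰`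
field `ψ_{i,n}`; divergence free: scalar symbols; real: the symbols `e^{-4π²t|ξ|²}` and `M_t(ξ)`
are real and even and the forcing of a real curve is real). [cite: Tao2016AveragedNS, Lemma 4.1 (4.14)] -/
theorem memH10df_duhamelModeField (hε : 0 < ε₀) (hu : ContinuousInH10On (Ici 0) u)
    (hreal : ∀ s, 0 ≤ s → IsReal (u s)) {t : ℝ} (ht : 0 ≤ t) :
    MemH10df (duhamelModeField 𝒟 α u i n X₀ n₀ t) := by
  have hε' : 0 < 1 + ε₀ := by linarith
  have hψ : MemH10df (cascadeWavelet ε₀ (𝒟.ψ i) n) := 𝒟.memH10df_cascadeWavelet hε' i n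
  have hQ : Continuous (modeForcing 𝒟 α u i n) := continuous_modeForcing hu
  refine MemH10df.add ((hψ.heat t).smul _) ⟨?_, ?_, hψ.2.2.fourierMultiplier _⟩
  · -- finite `H¹⁰` norm (`‖m(D)ψ‖_{H¹⁰} ≤ ‖m‖_∞ ‖ψ‖_{H¹⁰}`, tree `eFourierSobolevNorm_fourierMultiplier_le`)
    exact (eFourierSobolevNorm_fourierMultiplier_le 10 _ _).trans_lt (ENNReal.mul_lt_top enorm_lt_top hψ.1)
  · -- real
    rw [isReal_iff_conjL2_eq, duhamelSymbol_eq hQ,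
      conjL2_fourierMultiplier_of_real_even (memLp_top_duhamelSymbolFn hQ t)
        (conj_duhamelSymbolFn (conj_modeForcing hreal) ht) (duhamelSymbolFn_neg _ t),
      (isReal_iff_conjL2_eq _).1 hψ.2.1]

/-- **The identification `u_{i,n}(t) = F_{i,n}(t)`** (Tao, p. 22, the display after (4.14)): for a
global mild solution with datum `∑ⱼ X₀ⱼ ψ_{j,n₀}` and `t ≥ 0`,
`P_{i,n} u(t) = X₀ᵢ1_{n=n₀} e^{tΔ} ψ_{i,n} + M_t(D) ψ_{i,n}`.
Both sides lie in `H¹⁰_df` and have the same pairings against `H¹⁰_df`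
(`pairing_modeProjection_eq_pairing_duhamelModeField`); testing against their difference `w`,
`⟨w, w⟩ = 0`, so `w = 0` (`eq_zero_of_pairing_self_eq_zero`). [cite: Tao2016AveragedNS, Lemma 4.1 (4.14)] -/
theorem modeProjection_eq_duhamelModeField (hε : 0 < ε₀)
    (hu : IsMildSolutionFor (cascadeOperatorForm ε₀ 𝒟.ψ α) (shellDatum 𝒟 X₀ n₀) (Ici 0) u)
    {t : ℝ} (ht : 0 ≤ t) :
    modeProjection 𝒟 i n (u t) = duhamelModeField 𝒟 α u i n X₀ n₀ t := by
  have hP : MemH10df (modeProjection 𝒟 i n (u t)) := (hu.1 t ht).modeProjection 𝒟 i n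
  have hF : MemH10df (duhamelModeField 𝒟 α u i n X₀ n₀ t) :=
    memH10df_duhamelModeField hε hu.2.1 (fun s hs => (hu.1 s hs).2.1) ht
  have hw : MemH10df (modeProjection 𝒟 i n (u t) - duhamelModeField 𝒟 α u i n X₀ n₀ t) := hP.sub hF
  have h0 : pairing (modeProjection 𝒟 i n (u t) - duhamelModeField 𝒟 α u i n X₀ n₀ t)
      (modeProjection 𝒟 i n (u t) - duhamelModeField 𝒟 α u i n X₀ n₀ t) = 0 := by
    rw [pairing_sub_left, pairing_modeProjection_eq_pairing_duhamelModeField hε hu ht hw, sub_self]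
  exact sub_eq_zero.1 (eq_zero_of_pairing_self_eq_zero hw.2.1 h0)

end ModeFieldProps

/-! ## The coefficient and the energy of a mode as frequency integrals -/

section Formulas

variable {ε₀ : ℝ} {m : ℕ} {𝒟 : CascadeWaveletData ε₀ m}
  {α : Fin m → Fin m → Fin m → ℤ × ℤ × ℤ → ℝ} {u : ℝ → L2C} {X₀ : Fin m → ℝ} {i : Fin m} {n₀ n : ℤ}

/-- The full symbol of the mode: `m_t(ξ) = X₀ᵢ1_{n=n₀} e^{-4π²t|ξ|²} + M_t(ξ)`. [cite: Tao2016AveragedNS, Lemma 4.1 (4.14)] -/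
def modeSymbol (𝒟 : CascadeWaveletData ε₀ m) (α : Fin m → Fin m → Fin m → ℤ × ℤ × ℤ → ℝ)
    (u : ℝ → L2C) (i : Fin m) (n : ℤ) (X₀ : Fin m → ℝ) (n₀ : ℤ) (t : ℝ) (ξ : EuclideanSpace ℝ (Fin 3)) : ℂ :=
  ((shellDelta X₀ n₀ i n : ℝ) : ℂ) * heatSymbol t ξ + duhamelSymbolFn (modeForcing 𝒟 α u i n) t ξ

/-- **The Fourier transform of the Duhamel field**: `\widehat{F_{i,n}(t)} = m_t ψ̂_{i,n}` a.e. [cite: Tao2016AveragedNS, Lemma 4.1 (4.14)] -/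
theorem fourierFn_duhamelModeField (hu : ContinuousInH10On (Ici 0) u) (t : ℝ) :
    fourierFn (duhamelModeField 𝒟 α u i n X₀ n₀ t) =ᵐ[volume] fun ξ =>
      modeSymbol 𝒟 α u i n X₀ n₀ t ξ • fourierFn (cascadeWavelet ε₀ (𝒟.ψ i) n) ξ := by
  have hQ : Continuous (modeForcing 𝒟 α u i n) := continuous_modeForcing hu
  unfold duhamelModeField
  filter_upwards [fourierFn_add (((shellDelta X₀ n₀ i n : ℝ) : ℂ) • heat t (cascadeWavelet ε₀ (𝒟.ψ i) n))
      (fourierMultiplier (duhamelSymbol (modeForcing 𝒟 α u i n) t) (cascadeWavelet ε₀ (𝒟.ψ i) n)),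
    fourierFn_smul (((shellDelta X₀ n₀ i n : ℝ) : ℂ)) (heat t (cascadeWavelet ε₀ (𝒟.ψ i) n)),
    fourierFn_heat t (cascadeWavelet ε₀ (𝒟.ψ i) n),
    fourierFn_fourierMultiplier (duhamelSymbol (modeForcing 𝒟 α u i n) t) (cascadeWavelet ε₀ (𝒟.ψ i) n),
    coeFn_duhamelSymbol hQ t] with ξ h1 h2 h3 h4 h5
  rw [h1, h2, h3, h4, h5, modeSymbol, add_smul, smul_smul]

/-- The symbol of a real curve is real. [cite: Tao2016AveragedNS, Lemma 4.1] -/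
theorem conj_modeSymbol (hreal : ∀ s, 0 ≤ s → IsReal (u s)) {t : ℝ} (ht : 0 ≤ t)
    (ξ : EuclideanSpace ℝ (Fin 3)) : conj (modeSymbol 𝒟 α u i n X₀ n₀ t ξ) = modeSymbol 𝒟 α u i n X₀ n₀ t ξ := by
  rw [modeSymbol, map_add, map_mul, Complex.conj_ofReal, conj_heatSymbol,
    conj_duhamelSymbolFn (conj_modeForcing hreal) ht]

/-- The symbol of a real curve equals its real part. [cite: Tao2016AveragedNS, Lemma 4.1] -/
theorem modeSymbol_eq_ofReal_re (hreal : ∀ s, 0 ≤ s → IsReal (u s)) {t : ℝ} (ht : 0 ≤ t)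
    (ξ : EuclideanSpace ℝ (Fin 3)) :
    modeSymbol 𝒟 α u i n X₀ n₀ t ξ = (((modeSymbol 𝒟 α u i n X₀ n₀ t ξ).re : ℝ) : ℂ) :=
  eq_ofReal_re_of_im_eq_zero (Complex.conj_eq_iff_im.1 (conj_modeSymbol hreal ht ξ))

/-- **The coefficient as a frequency integral**: for a global mild solution and `t ≥ 0`,
`X_{i,n}(t) = ∫ Re m_t(ξ) |ψ̂_{i,n}(ξ)|² dξ` (`X_{i,n} = ⟨u, ψ_{i,n}⟩ = ⟨u_{i,n}, ψ_{i,n}⟩ = ⟨F_{i,n}, ψ_{i,n}⟩`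
and Parseval). [cite: Tao2016AveragedNS, Lemma 4.1 (4.14)] -/
theorem modeCoeff_eq_integral (hε : 0 < ε₀)
    (hu : IsMildSolutionFor (cascadeOperatorForm ε₀ 𝒟.ψ α) (shellDatum 𝒟 X₀ n₀) (Ici 0) u)
    {t : ℝ} (ht : 0 ≤ t) :
    modeCoeff 𝒟 u i n t =
      ∫ ξ, (modeSymbol 𝒟 α u i n X₀ n₀ t ξ).re * ‖fourierFn (cascadeWavelet ε₀ (𝒟.ψ i) n) ξ‖ ^ 2 := by
  have hreal : ∀ s, 0 ≤ s → IsReal (u s) := fun s hs => (hu.1 s hs).2.1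
  have hψreal : IsReal (cascadeWavelet ε₀ (𝒟.ψ i) n) := isReal_cascadeWavelet ε₀ (𝒟.ψ i) n
  have h1 : pairing (u t) (cascadeWavelet ε₀ (𝒟.ψ i) n) =
      pairing (duhamelModeField 𝒟 α u i n X₀ n₀ t) (cascadeWavelet ε₀ (𝒟.ψ i) n) := by
    rw [← modeProjection_eq_duhamelModeField hε hu ht, pairing_modeProjection_left,
      modeProjection_cascadeWavelet hε, if_pos ⟨rfl, rfl⟩]
  have h2 : pairing (duhamelModeField 𝒟 α u i n X₀ n₀ t) (cascadeWavelet ε₀ (𝒟.ψ i) n) =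
      ∫ ξ, (((modeSymbol 𝒟 α u i n X₀ n₀ t ξ).re * ‖fourierFn (cascadeWavelet ε₀ (𝒟.ψ i) n) ξ‖ ^ 2 : ℝ) : ℂ) := by
    rw [pairing_eq_integral_cdot_fourierFn]
    refine integral_congr_ae ?_
    filter_upwards [fourierFn_duhamelModeField hu.2.1 t, fourierFn_neg_eq_conj3 hψreal] with ξ h3 h4
    have hleft : ∀ (c : ℂ) (a b : EuclideanSpace ℂ (Fin 3)), cdot (c • a) b = c * cdot a b :=
      fun c a b => by simp [cdot, Finset.mul_sum, mul_assoc]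
    rw [h3, h4, hleft, cdot_conj3_self]
    conv_lhs => rw [modeSymbol_eq_ofReal_re hreal ht ξ]
    push_cast
    ring
  rw [modeCoeff, h1, h2, integral_complex_ofReal, Complex.ofReal_re]

/-- **The local energy as a frequency integral**: for a global mild solution and `t ≥ 0`,
`E_{i,n}(t) = ½ ∫ (Re m_t(ξ))² |ψ̂_{i,n}(ξ)|² dξ` (`E_{i,n} = ½‖u_{i,n}‖² = ½‖F_{i,n}‖²` and
Plancherel). [cite: Tao2016AveragedNS, Lemma 4.1 (4.5)] -/
theorem modeEnergy_eq_integral (hε : 0 < ε₀)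
    (hu : IsMildSolutionFor (cascadeOperatorForm ε₀ 𝒟.ψ α) (shellDatum 𝒟 X₀ n₀) (Ici 0) u)
    {t : ℝ} (ht : 0 ≤ t) :
    modeEnergy 𝒟 u i n t =
      (∫ ξ, (modeSymbol 𝒟 α u i n X₀ n₀ t ξ).re ^ 2 * ‖fourierFn (cascadeWavelet ε₀ (𝒟.ψ i) n) ξ‖ ^ 2) / 2 := by
  have hreal : ∀ s, 0 ≤ s → IsReal (u s) := fun s hs => (hu.1 s hs).2.1
  rw [modeEnergy, modeProjection_eq_duhamelModeField hε hu ht, norm_sq_eq_integral_fourierFn]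
  congr 1
  refine integral_congr_ae ?_
  filter_upwards [fourierFn_duhamelModeField hu.2.1 t] with ξ hξ
  rw [hξ, norm_smul, mul_pow]
  conv_lhs => rw [modeSymbol_eq_ofReal_re hreal ht ξ, Complex.norm_real, Real.norm_eq_abs, sq_abs]

end Formulas

/-! ## The scalar functions of a mode -/

section ModeScalars

variable {ε₀ : ℝ} {m : ℕ} {𝒟 : CascadeWaveletData ε₀ m}
  {α : Fin m → Fin m → Fin m → ℤ × ℤ × ℤ → ℝ} {u : ℝ → L2C} {X₀ : Fin m → ℝ} {i : Fin m} {n₀ n : ℤ}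

/-- The **mode's scalar coefficient** `X̃_{i,n}(t) = ∫ φ_{λ(ξ)}(t) ρ_{i,n}(ξ) dξ`, defined and smooth
for all `t ∈ ℝ`; it agrees with `X_{i,n}` on `[0,+∞)` (`modeCoeff_eq_modeScalarX`). [cite: Tao2016AveragedNS, Lemma 4.1 (4.14)] -/
def modeScalarX (𝒟 : CascadeWaveletData ε₀ m) (α : Fin m → Fin m → Fin m → ℤ × ℤ × ℤ → ℝ)
    (u : ℝ → L2C) (i : Fin m) (n : ℤ) (X₀ : Fin m → ℝ) (n₀ : ℤ) (t : ℝ) : ℝ :=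
  ∫ ξ, duhamelScalar (shellDelta X₀ n₀ i n) (modeForcingRe 𝒟 α u i n) (heatRate ξ) t * modeWeight 𝒟 i n ξ

/-- The **mode's scalar energy** `Ẽ_{i,n}(t) = ½ ∫ φ_{λ(ξ)}(t)² ρ_{i,n}(ξ) dξ`, defined and smooth
for all `t`; it agrees with `E_{i,n}` on `[0,+∞)` (`modeEnergy_eq_modeScalarE`). [cite: Tao2016AveragedNS, Lemma 4.1 (4.5)] -/
def modeScalarE (𝒟 : CascadeWaveletData ε₀ m) (α : Fin m → Fin m → Fin m → ℤ × ℤ × ℤ → ℝ)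
    (u : ℝ → L2C) (i : Fin m) (n : ℤ) (X₀ : Fin m → ℝ) (n₀ : ℤ) (t : ℝ) : ℝ :=
  (∫ ξ, duhamelScalar (shellDelta X₀ n₀ i n) (modeForcingRe 𝒟 α u i n) (heatRate ξ) t ^ 2 *
    modeWeight 𝒟 i n ξ) / 2

/-- **The symbol is the scalar Duhamel function**: for `t ≥ 0`,
`Re m_t(ξ) = φ_{λ(ξ)}(t) = e^{-λt}(δ + ∫₀ᵗ Qr e^{λs} ds)`. [cite: Tao2016AveragedNS, Lemma 4.1 (4.14)] -/
theorem modeSymbol_re_eq_duhamelScalar (hreal : ∀ s, 0 ≤ s → IsReal (u s)) {t : ℝ} (ht : 0 ≤ t)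
    (ξ : EuclideanSpace ℝ (Fin 3)) :
    (modeSymbol 𝒟 α u i n X₀ n₀ t ξ).re =
      duhamelScalar (shellDelta X₀ n₀ i n) (modeForcingRe 𝒟 α u i n) (heatRate ξ) t := by
  have hint : duhamelSymbolFn (modeForcing 𝒟 α u i n) t ξ =
      ((∫ s in (0 : ℝ)..t, modeForcingRe 𝒟 α u i n s * Real.exp (-(heatRate ξ * (t - s))) : ℝ) : ℂ) := by
    rw [duhamelSymbolFn, ← intervalIntegral.integral_ofReal]
    refine intervalIntegral.integral_congr fun s hs => ?_
    rw [uIcc_of_le ht] at hs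
    show modeForcing 𝒟 α u i n s * heatSymbol (t - s) ξ = _
    rw [modeForcing_eq_coe hreal, heatSymbol_eq_exp_heatRate (by linarith [hs.2])]
    push_cast
    ring
  rw [modeSymbol, hint, heatSymbol_eq_exp_heatRate ht, ← Complex.ofReal_mul, ← Complex.ofReal_add,
    Complex.ofReal_re, duhamelScalar, mul_add, ← intervalIntegral.integral_const_mul]
  congr 1
  · ring
  · refine intervalIntegral.integral_congr fun s _ => ?_
    show modeForcingRe 𝒟 α u i n s * Real.exp (-(heatRate ξ * (t - s))) = _
    rw [show -(heatRate ξ * (t - s)) = -(heatRate ξ * t) + heatRate ξ * s by ring, Real.exp_add]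
    ring

/-- **`X_{i,n} = X̃_{i,n}` on `[0,+∞)`.** [cite: Tao2016AveragedNS, Lemma 4.1 (4.14)] -/
theorem modeCoeff_eq_modeScalarX (hε : 0 < ε₀)
    (hu : IsMildSolutionFor (cascadeOperatorForm ε₀ 𝒟.ψ α) (shellDatum 𝒟 X₀ n₀) (Ici 0) u)
    {t : ℝ} (ht : 0 ≤ t) :
    modeCoeff 𝒟 u i n t = modeScalarX 𝒟 α u i n X₀ n₀ t := by
  rw [modeCoeff_eq_integral hε hu ht, modeScalarX]
  refine integral_congr_ae (Eventually.of_forall fun ξ => ?_)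
  simp only [modeWeight]
  rw [modeSymbol_re_eq_duhamelScalar (fun s hs => (hu.1 s hs).2.1) ht]

/-- **`E_{i,n} = Ẽ_{i,n}` on `[0,+∞)`.** [cite: Tao2016AveragedNS, Lemma 4.1 (4.5)] -/
theorem modeEnergy_eq_modeScalarE (hε : 0 < ε₀)
    (hu : IsMildSolutionFor (cascadeOperatorForm ε₀ 𝒟.ψ α) (shellDatum 𝒟 X₀ n₀) (Ici 0) u)
    {t : ℝ} (ht : 0 ≤ t) :
    modeEnergy 𝒟 u i n t = modeScalarE 𝒟 α u i n X₀ n₀ t := by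
  rw [modeEnergy_eq_integral hε hu ht, modeScalarE]
  congr 1
  refine integral_congr_ae (Eventually.of_forall fun ξ => ?_)
  simp only [modeWeight]
  rw [modeSymbol_re_eq_duhamelScalar (fun s hs => (hu.1 s hs).2.1) ht]

end ModeScalars

/-! ## Derivatives and estimates -/

section Estimates

variable {ε₀ : ℝ} {m : ℕ} {𝒟 : CascadeWaveletData ε₀ m}
  {α : Fin m → Fin m → Fin m → ℤ × ℤ × ℤ → ℝ} {u : ℝ → L2C} {X₀ : Fin m → ℝ} {i : Fin m} {n₀ n : ℤ}

/-- Shorthand: the mode's scalar function `φ_{λ(ξ)}(t)`. [folklore] -/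
abbrev modeφ (𝒟 : CascadeWaveletData ε₀ m) (α : Fin m → Fin m → Fin m → ℤ × ℤ × ℤ → ℝ)
    (u : ℝ → L2C) (i : Fin m) (n : ℤ) (X₀ : Fin m → ℝ) (n₀ : ℤ) (ξ : EuclideanSpace ℝ (Fin 3)) (t : ℝ) : ℝ :=
  duhamelScalar (shellDelta X₀ n₀ i n) (modeForcingRe 𝒟 α u i n) (heatRate ξ) t

/-- The **dissipation of the coefficient**, `A(t) = ∫ λ(ξ) φ(ξ,t) ρ(ξ) dξ` (`= -⟨Δ u_{i,n}, ψ_{i,n}⟩`, the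
`O((1+ε₀)^{2n} E^{1/2})` term of (4.10)). [cite: Tao2016AveragedNS, Lemma 4.1 (4.10)] -/
def modeDissX (𝒟 : CascadeWaveletData ε₀ m) (α : Fin m → Fin m → Fin m → ℤ × ℤ × ℤ → ℝ)
    (u : ℝ → L2C) (i : Fin m) (n : ℤ) (X₀ : Fin m → ℝ) (n₀ : ℤ) (t : ℝ) : ℝ :=
  ∫ ξ, modeφ 𝒟 α u i n X₀ n₀ ξ t ^ 1 * (heatRate ξ * modeWeight 𝒟 i n ξ)

/-- The **dissipation of the energy**, `B(t) = ∫ λ(ξ) φ(ξ,t)² ρ(ξ) dξ ≥ 0` (`= -⟨Δ u_{i,n}, u_{i,n}⟩`,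
dropped in (4.11)). [cite: Tao2016AveragedNS, Lemma 4.1 (4.11)] -/
def modeDissE (𝒟 : CascadeWaveletData ε₀ m) (α : Fin m → Fin m → Fin m → ℤ × ℤ × ℤ → ℝ)
    (u : ℝ → L2C) (i : Fin m) (n : ℤ) (X₀ : Fin m → ℝ) (n₀ : ℤ) (t : ℝ) : ℝ :=
  ∫ ξ, modeφ 𝒟 α u i n X₀ n₀ ξ t ^ 2 * (heatRate ξ * modeWeight 𝒟 i n ξ)

/-- `B(t) ≥ 0`. [cite: Tao2016AveragedNS, Lemma 4.1] -/
theorem modeDissE_nonneg (t : ℝ) : 0 ≤ modeDissE 𝒟 α u i n X₀ n₀ t :=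
  integral_nonneg fun ξ => mul_nonneg (sq_nonneg _) (mul_nonneg (heatRate_nonneg ξ) (modeWeight_nonneg ξ))

/-- **`X̃' = -A + Qr`** (differentiate under the integral; `∫ ρ = 1`). [cite: Tao2016AveragedNS, Lemma 4.1 (4.10)] -/
theorem hasDerivAt_modeScalarX (hε : 0 < 1 + ε₀) (hQ : Continuous (modeForcingRe 𝒟 α u i n)) (t : ℝ) :
    HasDerivAt (modeScalarX 𝒟 α u i n X₀ n₀)
      (-modeDissX 𝒟 α u i n X₀ n₀ t + modeForcingRe 𝒟 α u i n t) t := by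
  have h := (hasDerivAt_integral_duhamelScalar_pow (δ := shellDelta X₀ n₀ i n) hQ integrable_modeWeight
    (modeWeight_eq_zero (𝒟 := 𝒟) (i := i) (n := n) hε) 1 t)
  have hA := integrable_duhamelScalar_pow_mul (δ := shellDelta X₀ n₀ i n) hQ
    (integrable_heatRate_mul_modeWeight (𝒟 := 𝒟) (i := i) (n := n) hε)
    (heatRate_mul_modeWeight_eq_zero hε) 1 t
  have hform : (fun t => ∫ ξ, duhamelScalar (shellDelta X₀ n₀ i n) (modeForcingRe 𝒟 α u i n) (heatRate ξ) t ^ 1 *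
      modeWeight 𝒟 i n ξ) = modeScalarX 𝒟 α u i n X₀ n₀ := by
    funext s
    simp [modeScalarX]
  rw [hform] at h
  refine h.2.congr_deriv ?_
  have hsplit : ∀ ξ : EuclideanSpace ℝ (Fin 3), ((1 : ℕ) : ℝ) *
      duhamelScalar (shellDelta X₀ n₀ i n) (modeForcingRe 𝒟 α u i n) (heatRate ξ) t ^ (1 - 1) *
        (-(heatRate ξ) * duhamelScalar (shellDelta X₀ n₀ i n) (modeForcingRe 𝒟 α u i n) (heatRate ξ) t +
          modeForcingRe 𝒟 α u i n t) * modeWeight 𝒟 i n ξ =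
      modeForcingRe 𝒟 α u i n t * modeWeight 𝒟 i n ξ -
        duhamelScalar (shellDelta X₀ n₀ i n) (modeForcingRe 𝒟 α u i n) (heatRate ξ) t ^ 1 *
          (heatRate ξ * modeWeight 𝒟 i n ξ) := by
    intro ξ; ring
  simp_rw [hsplit]
  rw [integral_sub (integrable_modeWeight.const_mul _) hA, integral_const_mul,
    integral_modeWeight hε, mul_one, modeDissX]
  ring

/-- **`Ẽ' = -B + Qr X̃`** (differentiate under the integral). [cite: Tao2016AveragedNS, Lemma 4.1 (4.11)] -/
theorem hasDerivAt_modeScalarE (hε : 0 < 1 + ε₀) (hQ : Continuous (modeForcingRe 𝒟 α u i n)) (t : ℝ) :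
    HasDerivAt (modeScalarE 𝒟 α u i n X₀ n₀)
      (-modeDissE 𝒟 α u i n X₀ n₀ t + modeForcingRe 𝒟 α u i n t * modeScalarX 𝒟 α u i n X₀ n₀ t) t := by
  have h := (hasDerivAt_integral_duhamelScalar_pow (δ := shellDelta X₀ n₀ i n) hQ integrable_modeWeight
    (modeWeight_eq_zero (𝒟 := 𝒟) (i := i) (n := n) hε) 2 t)
  have hB := integrable_duhamelScalar_pow_mul (δ := shellDelta X₀ n₀ i n) hQ
    (integrable_heatRate_mul_modeWeight (𝒟 := 𝒟) (i := i) (n := n) hε)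
    (heatRate_mul_modeWeight_eq_zero hε) 2 t
  have hX := integrable_duhamelScalar_pow_mul (δ := shellDelta X₀ n₀ i n) hQ integrable_modeWeight
    (modeWeight_eq_zero (𝒟 := 𝒟) (i := i) (n := n) hε) 1 t
  have h2 := h.2.div_const 2
  have hform : (fun t => (∫ ξ, duhamelScalar (shellDelta X₀ n₀ i n) (modeForcingRe 𝒟 α u i n) (heatRate ξ) t ^ 2 *
      modeWeight 𝒟 i n ξ) / 2) = modeScalarE 𝒟 α u i n X₀ n₀ := by
    funext s
    simp [modeScalarE]
  rw [hform] at h2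
  refine h2.congr_deriv ?_
  have hsplit : ∀ ξ : EuclideanSpace ℝ (Fin 3), ((2 : ℕ) : ℝ) *
      duhamelScalar (shellDelta X₀ n₀ i n) (modeForcingRe 𝒟 α u i n) (heatRate ξ) t ^ (2 - 1) *
        (-(heatRate ξ) * duhamelScalar (shellDelta X₀ n₀ i n) (modeForcingRe 𝒟 α u i n) (heatRate ξ) t +
          modeForcingRe 𝒟 α u i n t) * modeWeight 𝒟 i n ξ =
      (2 : ℝ) * (modeForcingRe 𝒟 α u i n t *
        (duhamelScalar (shellDelta X₀ n₀ i n) (modeForcingRe 𝒟 α u i n) (heatRate ξ) t ^ 1 * modeWeight 𝒟 i n ξ) -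
        duhamelScalar (shellDelta X₀ n₀ i n) (modeForcingRe 𝒟 α u i n) (heatRate ξ) t ^ 2 *
          (heatRate ξ * modeWeight 𝒟 i n ξ)) := by
    intro ξ; ring
  simp_rw [hsplit]
  rw [integral_const_mul, integral_sub (hX.const_mul _) hB, integral_const_mul]
  simp only [modeDissE, modeScalarX, pow_one]
  ring

end Estimates

section Estimates2

variable {ε₀ : ℝ} {m : ℕ} {𝒟 : CascadeWaveletData ε₀ m}
  {α : Fin m → Fin m → Fin m → ℤ × ℤ × ℤ → ℝ} {u : ℝ → L2C} {X₀ : Fin m → ℝ} {i : Fin m} {n₀ n : ℤ}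

/-- `Ẽ ≥ 0`. [cite: Tao2016AveragedNS, Lemma 4.1] -/
theorem modeScalarE_nonneg (t : ℝ) : 0 ≤ modeScalarE 𝒟 α u i n X₀ n₀ t :=
  div_nonneg (integral_nonneg fun ξ => mul_nonneg (sq_nonneg _) (modeWeight_nonneg ξ)) zero_le_two

/-- **Cauchy–Schwarz against the probability density `ρ`**: `∫ |φ| ρ ≤ (∫ φ² ρ)^{1/2} = (2Ẽ)^{1/2}`
(Tao, p. 22: "From Cauchy–Schwarz we have `½X² ≤ E`" and "`O(E^{1/2} ‖Δψ_{i,n}‖)`"). [cite: Tao2016AveragedNS, Lemma 4.1 (4.12)] -/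
theorem integral_abs_modeφ_mul_le (hε : 0 < 1 + ε₀) (hQ : Continuous (modeForcingRe 𝒟 α u i n)) (t : ℝ) :
    ∫ ξ, |modeφ 𝒟 α u i n X₀ n₀ ξ t| * modeWeight 𝒟 i n ξ ≤ Real.sqrt (2 * modeScalarE 𝒟 α u i n X₀ n₀ t) := by
  have hcont : Continuous fun ξ : EuclideanSpace ℝ (Fin 3) => modeφ 𝒟 α u i n X₀ n₀ ξ t :=
    (continuous_duhamelScalar₂ hQ).comp (continuous_heatRate.prodMk continuous_const)
  have hρm : AEStronglyMeasurable (modeWeight 𝒟 i n) volume := integrable_modeWeight.aestronglyMeasurable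
  have hfm : AEStronglyMeasurable (fun ξ : EuclideanSpace ℝ (Fin 3) =>
      |modeφ 𝒟 α u i n X₀ n₀ ξ t| * Real.sqrt (modeWeight 𝒟 i n ξ)) volume :=
    (hcont.abs.aestronglyMeasurable).mul (Real.continuous_sqrt.comp_aestronglyMeasurable hρm)
  have hgm : AEStronglyMeasurable (fun ξ : EuclideanSpace ℝ (Fin 3) => Real.sqrt (modeWeight 𝒟 i n ξ)) volume :=
    Real.continuous_sqrt.comp_aestronglyMeasurable hρm
  have hf2 : ∀ ξ, (|modeφ 𝒟 α u i n X₀ n₀ ξ t| * Real.sqrt (modeWeight 𝒟 i n ξ)) ^ 2 =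
      modeφ 𝒟 α u i n X₀ n₀ ξ t ^ 2 * modeWeight 𝒟 i n ξ := fun ξ => by
    rw [mul_pow, sq_abs, Real.sq_sqrt (modeWeight_nonneg ξ)]
  have hg2 : ∀ ξ, Real.sqrt (modeWeight 𝒟 i n ξ) ^ 2 = modeWeight 𝒟 i n ξ := fun ξ =>
    Real.sq_sqrt (modeWeight_nonneg ξ)
  have hfL : MemLp (fun ξ : EuclideanSpace ℝ (Fin 3) =>
      |modeφ 𝒟 α u i n X₀ n₀ ξ t| * Real.sqrt (modeWeight 𝒟 i n ξ)) (ENNReal.ofReal 2) volume := by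
    rw [ENNReal.ofReal_ofNat, memLp_two_iff_integrable_sq hfm]
    simp_rw [hf2]
    exact integrable_duhamelScalar_pow_mul hQ integrable_modeWeight (modeWeight_eq_zero (𝒟 := 𝒟) hε) 2 t
  have hgL : MemLp (fun ξ : EuclideanSpace ℝ (Fin 3) => Real.sqrt (modeWeight 𝒟 i n ξ)) (ENNReal.ofReal 2) volume := by
    rw [ENNReal.ofReal_ofNat, memLp_two_iff_integrable_sq hgm]
    simp_rw [hg2]
    exact integrable_modeWeight
  have h := integral_mul_le_Lp_mul_Lq_of_nonneg Real.HolderConjugate.two_two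
    (Eventually.of_forall fun ξ => by positivity) (Eventually.of_forall fun ξ => Real.sqrt_nonneg _) hfL hgL
  have k1 : ∫ ξ, |modeφ 𝒟 α u i n X₀ n₀ ξ t| * Real.sqrt (modeWeight 𝒟 i n ξ) * Real.sqrt (modeWeight 𝒟 i n ξ) =
      ∫ ξ, |modeφ 𝒟 α u i n X₀ n₀ ξ t| * modeWeight 𝒟 i n ξ :=
    integral_congr_ae (Eventually.of_forall fun ξ => by
      simp only [mul_assoc, ← pow_two, Real.sq_sqrt (modeWeight_nonneg ξ)])
  have k2 : ∫ ξ, (|modeφ 𝒟 α u i n X₀ n₀ ξ t| * Real.sqrt (modeWeight 𝒟 i n ξ)) ^ (2 : ℝ) =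
      ∫ ξ, modeφ 𝒟 α u i n X₀ n₀ ξ t ^ 2 * modeWeight 𝒟 i n ξ :=
    integral_congr_ae (Eventually.of_forall fun ξ => by simp only [Real.rpow_two, hf2])
  have k3 : ∫ ξ, Real.sqrt (modeWeight 𝒟 i n ξ) ^ (2 : ℝ) = 1 := by
    rw [← integral_modeWeight (𝒟 := 𝒟) (i := i) (n := n) hε]
    exact integral_congr_ae (Eventually.of_forall fun ξ => by simp only [Real.rpow_two, hg2])
  rw [k1, k2, k3, Real.one_rpow, mul_one] at h
  refine h.trans (le_of_eq ?_)
  rw [Real.sqrt_eq_rpow, modeScalarE]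
  congr 1
  ring

/-- `|X̃| ≤ (2Ẽ)^{1/2}`, i.e. **(4.12), lower half: `½ X̃² ≤ Ẽ`** (below). [cite: Tao2016AveragedNS, Lemma 4.1 (4.12)] -/
theorem abs_modeScalarX_le (hε : 0 < 1 + ε₀) (hQ : Continuous (modeForcingRe 𝒟 α u i n)) (t : ℝ) :
    |modeScalarX 𝒟 α u i n X₀ n₀ t| ≤ Real.sqrt (2 * modeScalarE 𝒟 α u i n X₀ n₀ t) := by
  refine le_trans ?_ (integral_abs_modeφ_mul_le hε hQ t)
  rw [modeScalarX, ← Real.norm_eq_abs]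
  refine (norm_integral_le_integral_norm _).trans (le_of_eq (integral_congr_ae (Eventually.of_forall fun ξ => ?_)))
  simp only [Real.norm_eq_abs, abs_mul, abs_of_nonneg (modeWeight_nonneg ξ)]

/-- **(4.12), lower half**: `½ X̃² ≤ Ẽ`. [cite: Tao2016AveragedNS, Lemma 4.1 (4.12)] -/
theorem half_sq_modeScalarX_le (hε : 0 < 1 + ε₀) (hQ : Continuous (modeForcingRe 𝒟 α u i n)) (t : ℝ) :
    (1 / 2) * modeScalarX 𝒟 α u i n X₀ n₀ t ^ 2 ≤ modeScalarE 𝒟 α u i n X₀ n₀ t := by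
  have h := abs_modeScalarX_le (X₀ := X₀) (n₀ := n₀) hε hQ t
  have hE := modeScalarE_nonneg (𝒟 := 𝒟) (α := α) (u := u) (i := i) (n := n) (X₀ := X₀) (n₀ := n₀) t
  have h2 : modeScalarX 𝒟 α u i n X₀ n₀ t ^ 2 ≤ 2 * modeScalarE 𝒟 α u i n X₀ n₀ t := by
    calc modeScalarX 𝒟 α u i n X₀ n₀ t ^ 2 = |modeScalarX 𝒟 α u i n X₀ n₀ t| ^ 2 := (sq_abs _).symm
      _ ≤ Real.sqrt (2 * modeScalarE 𝒟 α u i n X₀ n₀ t) ^ 2 := pow_le_pow_left₀ (abs_nonneg _) h 2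
      _ = 2 * modeScalarE 𝒟 α u i n X₀ n₀ t := Real.sq_sqrt (by linarith)
  linarith

/-- **The dissipation of the coefficient is `O(Λ_n E^{1/2})`**: `|A(t)| ≤ Λ_n (2Ẽ(t))^{1/2}`
(`⟨Δu_{i,n}, ψ_{i,n}⟩ = O(E^{1/2} ‖Δψ_{i,n}‖) = O((1+ε₀)^{2n} E^{1/2})`, p. 22). [cite: Tao2016AveragedNS, Lemma 4.1 (4.10)] -/
theorem abs_modeDissX_le (hε : 0 < 1 + ε₀) (hQ : Continuous (modeForcingRe 𝒟 α u i n)) (t : ℝ) :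
    |modeDissX 𝒟 α u i n X₀ n₀ t| ≤ modeRateBound ε₀ n * Real.sqrt (2 * modeScalarE 𝒟 α u i n X₀ n₀ t) := by
  have hA := integrable_duhamelScalar_pow_mul (δ := shellDelta X₀ n₀ i n) hQ
    (integrable_heatRate_mul_modeWeight (𝒟 := 𝒟) (i := i) (n := n) hε) (heatRate_mul_modeWeight_eq_zero hε) 1 t
  have h1 := integrable_duhamelScalar_pow_mul (δ := shellDelta X₀ n₀ i n) hQ integrable_modeWeight
    (modeWeight_eq_zero (𝒟 := 𝒟) (i := i) (n := n) hε) 1 t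
  calc |modeDissX 𝒟 α u i n X₀ n₀ t|
      ≤ ∫ ξ, ‖modeφ 𝒟 α u i n X₀ n₀ ξ t ^ 1 * (heatRate ξ * modeWeight 𝒟 i n ξ)‖ := by
        rw [modeDissX, ← Real.norm_eq_abs]
        exact norm_integral_le_integral_norm _
    _ ≤ ∫ ξ, modeRateBound ε₀ n * (|modeφ 𝒟 α u i n X₀ n₀ ξ t| * modeWeight 𝒟 i n ξ) := by
        refine integral_mono_ae hA.norm ?_ ?_
        · have := (h1.norm).const_mul (modeRateBound ε₀ n)
          refine this.congr (Eventually.of_forall fun ξ => ?_)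
          simp only [pow_one, Real.norm_eq_abs, abs_mul, abs_of_nonneg (modeWeight_nonneg ξ)]
        · filter_upwards [modeWeight_eq_zero (𝒟 := 𝒟) (i := i) (n := n) hε] with ξ hξ
          simp only [pow_one, Real.norm_eq_abs, abs_mul, abs_of_nonneg (modeWeight_nonneg ξ),
            abs_of_nonneg (heatRate_nonneg ξ)]
          by_cases hR : ‖ξ‖ ≤ modeRadius ε₀ n
          · have := heatRate_le (mem_closedBall_zero_iff.2 hR)
            have h0 : 0 ≤ |modeφ 𝒟 α u i n X₀ n₀ ξ t| * modeWeight 𝒟 i n ξ :=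
              mul_nonneg (abs_nonneg _) (modeWeight_nonneg ξ)
            calc |modeφ 𝒟 α u i n X₀ n₀ ξ t| * (heatRate ξ * modeWeight 𝒟 i n ξ)
                = heatRate ξ * (|modeφ 𝒟 α u i n X₀ n₀ ξ t| * modeWeight 𝒟 i n ξ) := by ring
              _ ≤ modeRateBound ε₀ n * (|modeφ 𝒟 α u i n X₀ n₀ ξ t| * modeWeight 𝒟 i n ξ) :=
                  mul_le_mul_of_nonneg_right this h0
          · rw [hξ (not_le.1 hR)]
            simp
    _ = modeRateBound ε₀ n * ∫ ξ, |modeφ 𝒟 α u i n X₀ n₀ ξ t| * modeWeight 𝒟 i n ξ := integral_const_mul _ _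
    _ ≤ modeRateBound ε₀ n * Real.sqrt (2 * modeScalarE 𝒟 α u i n X₀ n₀ t) :=
        mul_le_mul_of_nonneg_left (integral_abs_modeφ_mul_le hε hQ t) (modeRateBound_nonneg ε₀ n)

end Estimates2

/-! ## Regularity, (4.10)–(4.12) and the initial conditions -/

section Regularity

variable {ε₀ : ℝ} {m : ℕ} {𝒟 : CascadeWaveletData ε₀ m}
  {α : Fin m → Fin m → Fin m → ℤ × ℤ × ℤ → ℝ} {u : ℝ → L2C} {X₀ : Fin m → ℝ} {i : Fin m} {n₀ n : ℤ}

/-- `A` is differentiable (same dominated differentiation, with the rate-weighted density), in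
particular continuous. [cite: Tao2016AveragedNS, Lemma 4.1] -/
theorem continuous_modeDissX (hε : 0 < 1 + ε₀) (hQ : Continuous (modeForcingRe 𝒟 α u i n)) :
    Continuous (modeDissX 𝒟 α u i n X₀ n₀) := by
  have h : ∀ t, HasDerivAt (modeDissX 𝒟 α u i n X₀ n₀) _ t := fun t =>
    (hasDerivAt_integral_duhamelScalar_pow (δ := shellDelta X₀ n₀ i n) hQ
      (integrable_heatRate_mul_modeWeight (𝒟 := 𝒟) (i := i) (n := n) hε)
      (heatRate_mul_modeWeight_eq_zero hε) 1 t).2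
  exact continuous_iff_continuousAt.2 fun t => (h t).continuousAt

/-- `B` is continuous. [cite: Tao2016AveragedNS, Lemma 4.1] -/
theorem continuous_modeDissE (hε : 0 < 1 + ε₀) (hQ : Continuous (modeForcingRe 𝒟 α u i n)) :
    Continuous (modeDissE 𝒟 α u i n X₀ n₀) := by
  have h : ∀ t, HasDerivAt (modeDissE 𝒟 α u i n X₀ n₀) _ t := fun t =>
    (hasDerivAt_integral_duhamelScalar_pow (δ := shellDelta X₀ n₀ i n) hQ
      (integrable_heatRate_mul_modeWeight (𝒟 := 𝒟) (i := i) (n := n) hε)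
      (heatRate_mul_modeWeight_eq_zero hε) 2 t).2
  exact continuous_iff_continuousAt.2 fun t => (h t).continuousAt

/-- `X̃` is continuous. [cite: Tao2016AveragedNS, Lemma 4.1] -/
theorem continuous_modeScalarX (hε : 0 < 1 + ε₀) (hQ : Continuous (modeForcingRe 𝒟 α u i n)) :
    Continuous (modeScalarX 𝒟 α u i n X₀ n₀) :=
  continuous_iff_continuousAt.2 fun t => (hasDerivAt_modeScalarX hε hQ t).continuousAt

/-- **`X̃` is `C¹` on `ℝ`** (its derivative `-A + Qr` is continuous). [cite: Tao2016AveragedNS, Lemma 4.1] -/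
theorem contDiff_modeScalarX (hε : 0 < 1 + ε₀) (hQ : Continuous (modeForcingRe 𝒟 α u i n)) :
    ContDiff ℝ 1 (modeScalarX 𝒟 α u i n X₀ n₀) := by
  rw [contDiff_one_iff_deriv]
  refine ⟨fun t => (hasDerivAt_modeScalarX hε hQ t).differentiableAt, ?_⟩
  have h : deriv (modeScalarX 𝒟 α u i n X₀ n₀) = fun t =>
      -modeDissX 𝒟 α u i n X₀ n₀ t + modeForcingRe 𝒟 α u i n t :=
    funext fun t => (hasDerivAt_modeScalarX hε hQ t).deriv
  rw [h]
  exact (continuous_modeDissX hε hQ).neg.add hQ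

/-- **`Ẽ` is `C¹` on `ℝ`** (its derivative `-B + Qr X̃` is continuous). [cite: Tao2016AveragedNS, Lemma 4.1] -/
theorem contDiff_modeScalarE (hε : 0 < 1 + ε₀) (hQ : Continuous (modeForcingRe 𝒟 α u i n)) :
    ContDiff ℝ 1 (modeScalarE 𝒟 α u i n X₀ n₀) := by
  rw [contDiff_one_iff_deriv]
  refine ⟨fun t => (hasDerivAt_modeScalarE hε hQ t).differentiableAt, ?_⟩
  have h : deriv (modeScalarE 𝒟 α u i n X₀ n₀) = fun t =>
      -modeDissE 𝒟 α u i n X₀ n₀ t + modeForcingRe 𝒟 α u i n t * modeScalarX 𝒟 α u i n X₀ n₀ t :=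
    funext fun t => (hasDerivAt_modeScalarE hε hQ t).deriv
  rw [h]
  exact (continuous_modeDissE hε hQ).neg.add (hQ.mul (continuous_modeScalarX hε hQ))

/-- The real forcing of a mild solution is continuous. [cite: Tao2016AveragedNS, Lemma 4.1] -/
theorem continuous_modeForcingRe_of_mild
    (hu : IsMildSolutionFor (cascadeOperatorForm ε₀ 𝒟.ψ α) (shellDatum 𝒟 X₀ n₀) (Ici 0) u) :
    Continuous (modeForcingRe 𝒟 α u i n) :=
  continuous_modeForcingRe hu.2.1 fun s hs => (hu.1 s hs).2.1

/-- **`X_{i,n}` is continuously differentiable on `[0,+∞)`** (Lemma 4.1: "the `X_{i,n}` are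
continuously differentiable"). [cite: Tao2016AveragedNS, Lemma 4.1] -/
theorem contDiffOn_modeCoeff_of_mild (hε : 0 < ε₀)
    (hu : IsMildSolutionFor (cascadeOperatorForm ε₀ 𝒟.ψ α) (shellDatum 𝒟 X₀ n₀) (Ici 0) u) :
    ContDiffOn ℝ 1 (modeCoeff 𝒟 u i n) (Ici 0) := by
  have hε' : 0 < 1 + ε₀ := by linarith
  exact (contDiff_modeScalarX (i := i) (n := n) (X₀ := X₀) (n₀ := n₀) hε'
    (continuous_modeForcingRe_of_mild (i := i) (n := n) hu)).contDiffOn.congr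
    fun t ht => modeCoeff_eq_modeScalarX hε hu ht

/-- **`E_{i,n}` is continuously differentiable on `[0,+∞)`.** [cite: Tao2016AveragedNS, Lemma 4.1] -/
theorem contDiffOn_modeEnergy_of_mild (hε : 0 < ε₀)
    (hu : IsMildSolutionFor (cascadeOperatorForm ε₀ 𝒟.ψ α) (shellDatum 𝒟 X₀ n₀) (Ici 0) u) :
    ContDiffOn ℝ 1 (modeEnergy 𝒟 u i n) (Ici 0) := by
  have hε' : 0 < 1 + ε₀ := by linarith
  exact (contDiff_modeScalarE (i := i) (n := n) (X₀ := X₀) (n₀ := n₀) hε'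
    (continuous_modeForcingRe_of_mild (i := i) (n := n) hu)).contDiffOn.congr
    fun t ht => modeEnergy_eq_modeScalarE hε hu ht

/-- The one-sided derivative of `X_{i,n}` on `[0,+∞)`: `∂ₜX_{i,n} = -A + quadTerm_{i,n}`. [cite: Tao2016AveragedNS, Lemma 4.1 (4.10)] -/
theorem derivWithin_modeCoeff_of_mild (hε : 0 < ε₀)
    (hu : IsMildSolutionFor (cascadeOperatorForm ε₀ 𝒟.ψ α) (shellDatum 𝒟 X₀ n₀) (Ici 0) u) {t : ℝ} (ht : 0 ≤ t) :
    derivWithin (modeCoeff 𝒟 u i n) (Ici 0) t =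
      -modeDissX 𝒟 α u i n X₀ n₀ t + TaoCascade.quadTerm ε₀ α (modeCoeff 𝒟 u) i n t := by
  have hε' : 0 < 1 + ε₀ := by linarith
  have h := (hasDerivAt_modeScalarX (i := i) (n := n) (X₀ := X₀) (n₀ := n₀) hε'
    (continuous_modeForcingRe_of_mild (i := i) (n := n) hu) t).hasDerivWithinAt (s := Ici 0)
  have h2 : HasDerivWithinAt (modeCoeff 𝒟 u i n)
      (-modeDissX 𝒟 α u i n X₀ n₀ t + modeForcingRe 𝒟 α u i n t) (Ici 0) t :=
    h.congr (fun s hs => modeCoeff_eq_modeScalarX hε hu hs) (modeCoeff_eq_modeScalarX hε hu ht)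
  rw [h2.derivWithin (uniqueDiffOn_Ici 0 t ht), modeForcingRe_of_nonneg ht]

/-- The one-sided derivative of `E_{i,n}` on `[0,+∞)`: `∂ₜE_{i,n} = -B + quadTerm_{i,n} X_{i,n}`. [cite: Tao2016AveragedNS, Lemma 4.1 (4.11)] -/
theorem derivWithin_modeEnergy_of_mild (hε : 0 < ε₀)
    (hu : IsMildSolutionFor (cascadeOperatorForm ε₀ 𝒟.ψ α) (shellDatum 𝒟 X₀ n₀) (Ici 0) u) {t : ℝ} (ht : 0 ≤ t) :
    derivWithin (modeEnergy 𝒟 u i n) (Ici 0) t =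
      -modeDissE 𝒟 α u i n X₀ n₀ t + TaoCascade.quadTerm ε₀ α (modeCoeff 𝒟 u) i n t * modeCoeff 𝒟 u i n t := by
  have hε' : 0 < 1 + ε₀ := by linarith
  have h := (hasDerivAt_modeScalarE (i := i) (n := n) (X₀ := X₀) (n₀ := n₀) hε'
    (continuous_modeForcingRe_of_mild (i := i) (n := n) hu) t).hasDerivWithinAt (s := Ici 0)
  have h2 : HasDerivWithinAt (modeEnergy 𝒟 u i n)
      (-modeDissE 𝒟 α u i n X₀ n₀ t + modeForcingRe 𝒟 α u i n t * modeScalarX 𝒟 α u i n X₀ n₀ t) (Ici 0) t :=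
    h.congr (fun s hs => modeEnergy_eq_modeScalarE hε hu hs) (modeEnergy_eq_modeScalarE hε hu ht)
  rw [h2.derivWithin (uniqueDiffOn_Ici 0 t ht), modeForcingRe_of_nonneg ht, ← modeCoeff_eq_modeScalarX hε hu ht]

/-- **The energy inequality (4.11)**: `∂ₜ E_{i,n} ≤ quadTerm_{i,n} · X_{i,n}` on `[0,+∞)` (the dissipation
`B = -⟨Δu_{i,n}, u_{i,n}⟩ ≥ 0` is dropped). [cite: Tao2016AveragedNS, Lemma 4.1 (4.11)] -/
theorem energy_ineq_of_mild (hε : 0 < ε₀)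
    (hu : IsMildSolutionFor (cascadeOperatorForm ε₀ 𝒟.ψ α) (shellDatum 𝒟 X₀ n₀) (Ici 0) u) {t : ℝ} (ht : 0 ≤ t) :
    derivWithin (modeEnergy 𝒟 u i n) (Ici 0) t ≤
      TaoCascade.quadTerm ε₀ α (modeCoeff 𝒟 u) i n t * modeCoeff 𝒟 u i n t := by
  rw [derivWithin_modeEnergy_of_mild (X₀ := X₀) (n₀ := n₀) hε hu ht]
  linarith [modeDissE_nonneg (𝒟 := 𝒟) (α := α) (u := u) (i := i) (n := n) (X₀ := X₀) (n₀ := n₀) t]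

end Regularity

section Bounds

variable {ε₀ : ℝ} {m : ℕ} {𝒟 : CascadeWaveletData ε₀ m}
  {α : Fin m → Fin m → Fin m → ℤ × ℤ × ℤ → ℝ} {u : ℝ → L2C} {X₀ : Fin m → ℝ} {i : Fin m} {n₀ n : ℤ}

/-- **The equation of motion (4.10)**:
`|∂ₜX_{i,n} - quadTerm_{i,n}| ≤ K₁ (1+ε₀)^{2n} E_{i,n}^{1/2}` on `[0,+∞)`. [cite: Tao2016AveragedNS, Lemma 4.1 (4.10)] -/
theorem motion_of_mild (hε : 0 < ε₀)
    (hu : IsMildSolutionFor (cascadeOperatorForm ε₀ 𝒟.ψ α) (shellDatum 𝒟 X₀ n₀) (Ici 0) u)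
    {t : ℝ} (ht : 0 ≤ t) :
    |derivWithin (modeCoeff 𝒟 u i n) (Ici 0) t - TaoCascade.quadTerm ε₀ α (modeCoeff 𝒟 u) i n t| ≤
      4 * Real.sqrt 2 * Real.pi ^ 2 * (1 + ε₀ / 2) ^ 2 * (1 + ε₀) ^ ((2 : ℝ) * n) * Real.sqrt (modeEnergy 𝒟 u i n t) := by
  have hε' : 0 < 1 + ε₀ := by linarith
  have hQ := continuous_modeForcingRe_of_mild (i := i) (n := n) hu
  rw [derivWithin_modeCoeff_of_mild (X₀ := X₀) (n₀ := n₀) hε hu ht,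
    show -modeDissX 𝒟 α u i n X₀ n₀ t + TaoCascade.quadTerm ε₀ α (modeCoeff 𝒟 u) i n t -
      TaoCascade.quadTerm ε₀ α (modeCoeff 𝒟 u) i n t = -modeDissX 𝒟 α u i n X₀ n₀ t by ring, abs_neg]
  refine (abs_modeDissX_le hε' hQ t).trans (le_of_eq ?_)
  rw [← modeEnergy_eq_modeScalarE hε hu ht, Real.sqrt_mul' _ (modeEnergy_nonneg 𝒟 u i n t),
    modeRateBound_eq hε']
  ring

/-- **The energy defect (4.12), lower half**: `½ X_{i,n}² ≤ E_{i,n}` on `[0,+∞)`. [cite: Tao2016AveragedNS, Lemma 4.1 (4.12)] -/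
theorem defect_lower_of_mild (hε : 0 < ε₀)
    (hu : IsMildSolutionFor (cascadeOperatorForm ε₀ 𝒟.ψ α) (shellDatum 𝒟 X₀ n₀) (Ici 0) u)
    {t : ℝ} (ht : 0 ≤ t) :
    (1 / 2) * modeCoeff 𝒟 u i n t ^ 2 ≤ modeEnergy 𝒟 u i n t := by
  have hε' : 0 < 1 + ε₀ := by linarith
  rw [modeCoeff_eq_modeScalarX (X₀ := X₀) (n₀ := n₀) hε hu ht, modeEnergy_eq_modeScalarE (X₀ := X₀) (n₀ := n₀) hε hu ht]
  exact half_sq_modeScalarX_le hε' (continuous_modeForcingRe_of_mild hu) t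

/-- **Initial values**: `X̃(0) = δ`, `Ẽ(0) = δ²/2`. [cite: Tao2016AveragedNS, Lemma 4.1 (4.8)–(4.9)] -/
theorem modeScalar_zero (hε : 0 < 1 + ε₀) :
    modeScalarX 𝒟 α u i n X₀ n₀ 0 = shellDelta X₀ n₀ i n ∧
      modeScalarE 𝒟 α u i n X₀ n₀ 0 = shellDelta X₀ n₀ i n ^ 2 / 2 := by
  constructor
  · simp only [modeScalarX, duhamelScalar_zero, integral_const_mul, integral_modeWeight hε, mul_one]
  · simp only [modeScalarE, duhamelScalar_zero, integral_const_mul, integral_modeWeight hε, mul_one]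

/-- **The initial conditions (4.8)–(4.9) for the shell datum**: `X_{i,n}(0) = X₀ᵢ 1_{n=n₀}`,
`E_{i,n}(0) = ½ X_{i,n}(0)²`. [cite: Tao2016AveragedNS, Lemma 4.1 (4.8)–(4.9)] -/
theorem init_of_mild (hε : 0 < ε₀)
    (hu : IsMildSolutionFor (cascadeOperatorForm ε₀ 𝒟.ψ α) (shellDatum 𝒟 X₀ n₀) (Ici 0) u) :
    modeCoeff 𝒟 u i n 0 = (if n = n₀ then X₀ i else 0) ∧
      modeEnergy 𝒟 u i n 0 = (1 / 2) * modeCoeff 𝒟 u i n 0 ^ 2 := by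
  have hε' : 0 < 1 + ε₀ := by linarith
  obtain ⟨hX, hE⟩ := modeScalar_zero (𝒟 := 𝒟) (α := α) (u := u) (i := i) (n := n) (X₀ := X₀) (n₀ := n₀) hε'
  rw [modeCoeff_eq_modeScalarX (X₀ := X₀) (n₀ := n₀) hε hu le_rfl,
    modeEnergy_eq_modeScalarE (X₀ := X₀) (n₀ := n₀) hε hu le_rfl, hX, hE]
  exact ⟨rfl, by ring⟩

/-- **The energy defect (4.12), upper half**:
`E_{i,n}(t) ≤ ½ X_{i,n}(t)² + K₂ (1+ε₀)^{2n} ∫₀ᵗ E_{i,n}` on `[0,+∞)` (`∂ₜ(E - ½X²) = -B + X A ≤ 2Λ_n E`,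
`E - ½X²` vanishes at `0`, and the fundamental theorem of calculus; Tao p. 22). [cite: Tao2016AveragedNS, Lemma 4.1 (4.12)] -/
theorem defect_upper_of_mild (hε : 0 < ε₀)
    (hu : IsMildSolutionFor (cascadeOperatorForm ε₀ 𝒟.ψ α) (shellDatum 𝒟 X₀ n₀) (Ici 0) u)
    {t : ℝ} (ht : 0 ≤ t) :
    modeEnergy 𝒟 u i n t ≤ (1 / 2) * modeCoeff 𝒟 u i n t ^ 2 +
      8 * Real.pi ^ 2 * (1 + ε₀ / 2) ^ 2 * (1 + ε₀) ^ ((2 : ℝ) * n) * ∫ s in (0 : ℝ)..t, modeEnergy 𝒟 u i n s := by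
  have hε' : 0 < 1 + ε₀ := by linarith
  have hQ := continuous_modeForcingRe_of_mild (i := i) (n := n) hu
  set Λ := modeRateBound ε₀ n with hΛ
  set X := modeScalarX 𝒟 α u i n X₀ n₀ with hXdef
  set E := modeScalarE 𝒟 α u i n X₀ n₀ with hEdef
  have hEc : Continuous E := (contDiff_modeScalarE (i := i) (n := n) (X₀ := X₀) (n₀ := n₀) hε' hQ).continuous
  -- the comparison function and its derivative
  set g : ℝ → ℝ := fun τ => E τ - (1 / 2) * X τ ^ 2 - 2 * Λ * ∫ s in (0 : ℝ)..τ, E s with hg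
  have hgd : ∀ τ, HasDerivAt g ((-modeDissE 𝒟 α u i n X₀ n₀ τ + modeForcingRe 𝒟 α u i n τ * X τ) -
      (1 / 2) * (2 * X τ ^ (2 - 1) * (-modeDissX 𝒟 α u i n X₀ n₀ τ + modeForcingRe 𝒟 α u i n τ)) -
      2 * Λ * E τ) τ := by
    intro τ
    have h1 := hasDerivAt_modeScalarE (i := i) (n := n) (X₀ := X₀) (n₀ := n₀) hε' hQ τ
    have h2 := ((hasDerivAt_modeScalarX (i := i) (n := n) (X₀ := X₀) (n₀ := n₀) hε' hQ τ).pow 2).const_mul (1 / 2 : ℝ)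
    have h3 := (intervalIntegral.integral_hasDerivAt_right (hEc.intervalIntegrable 0 τ)
      (hEc.stronglyMeasurableAtFilter _ _) hEc.continuousAt).const_mul (2 * Λ)
    have h := (h1.sub h2).sub h3
    refine h.congr_deriv ?_
    push_cast
    ring
  have hg'le : ∀ τ, (-modeDissE 𝒟 α u i n X₀ n₀ τ + modeForcingRe 𝒟 α u i n τ * X τ) -
      (1 / 2) * (2 * X τ ^ (2 - 1) * (-modeDissX 𝒟 α u i n X₀ n₀ τ + modeForcingRe 𝒟 α u i n τ)) -
      2 * Λ * E τ ≤ 0 := by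
    intro τ
    have hB := modeDissE_nonneg (𝒟 := 𝒟) (α := α) (u := u) (i := i) (n := n) (X₀ := X₀) (n₀ := n₀) τ
    have hA := abs_modeDissX_le (X₀ := X₀) (n₀ := n₀) hε' hQ τ
    have hXa := abs_modeScalarX_le (X₀ := X₀) (n₀ := n₀) hε' hQ τ
    have hE0 := modeScalarE_nonneg (𝒟 := 𝒟) (α := α) (u := u) (i := i) (n := n) (X₀ := X₀) (n₀ := n₀) τ
    have hXA : X τ * modeDissX 𝒟 α u i n X₀ n₀ τ ≤ 2 * Λ * E τ := by
      calc X τ * modeDissX 𝒟 α u i n X₀ n₀ τ ≤ |X τ| * |modeDissX 𝒟 α u i n X₀ n₀ τ| := by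
            rw [← abs_mul]; exact le_abs_self _
        _ ≤ Real.sqrt (2 * E τ) * (Λ * Real.sqrt (2 * E τ)) :=
            mul_le_mul hXa hA (abs_nonneg _) (Real.sqrt_nonneg _)
        _ = 2 * Λ * E τ := by
            rw [show Real.sqrt (2 * E τ) * (Λ * Real.sqrt (2 * E τ)) = Λ * (Real.sqrt (2 * E τ) * Real.sqrt (2 * E τ)) by ring,
              Real.mul_self_sqrt (by linarith)]
            ring
    simp only [pow_one, show (2 : ℕ) - 1 = 1 from rfl]
    nlinarith
  -- `g` is antitone on `[0,∞)` and vanishes at `0`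
  have hanti : AntitoneOn g (Ici 0) :=
    antitoneOn_of_deriv_nonpos (convex_Ici 0) (fun τ _ => (hgd τ).continuousAt.continuousWithinAt)
      (fun τ _ => (hgd τ).differentiableAt.differentiableWithinAt) fun τ _ => by
        rw [(hgd τ).deriv]; exact hg'le τ
  have hg0 : g 0 = 0 := by
    obtain ⟨hX0, hE0⟩ := modeScalar_zero (𝒟 := 𝒟) (α := α) (u := u) (i := i) (n := n) (X₀ := X₀) (n₀ := n₀) hε'
    simp only [hg, hXdef, hEdef, hX0, hE0, intervalIntegral.integral_same, mul_zero, sub_zero]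
    ring
  have hgt : g t ≤ 0 := hg0 ▸ hanti (mem_Ici.2 le_rfl) (mem_Ici.2 ht) ht
  -- translate back to `X_{i,n}`, `E_{i,n}`
  have hint : ∫ s in (0 : ℝ)..t, modeEnergy 𝒟 u i n s = ∫ s in (0 : ℝ)..t, E s := by
    refine intervalIntegral.integral_congr fun s hs => ?_
    rw [uIcc_of_le ht] at hs
    exact modeEnergy_eq_modeScalarE hε hu hs.1
  rw [modeCoeff_eq_modeScalarX (X₀ := X₀) (n₀ := n₀) hε hu ht, modeEnergy_eq_modeScalarE (X₀ := X₀) (n₀ := n₀) hε hu ht,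
    hint, ← hXdef, ← hEdef]
  have h2Λ : 2 * Λ = 8 * Real.pi ^ 2 * (1 + ε₀ / 2) ^ 2 * (1 + ε₀) ^ ((2 : ℝ) * n) := by
    rw [hΛ, modeRateBound_eq hε']; ring
  have := hgt
  simp only [hg] at this
  rw [← h2Λ]
  linarith

end Bounds

end ShellDatum

end Literature.Analysis.FluidPDE.Tao2016
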